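import Literature.Geometry.Riemannian.WeightedHeatFlowFromLinearHeat
import Literature.Geometry.Riemannian.LinearHeatCauchyExistence
import Literature.Geometry.Riemannian.MetricFamilyExtension
import HarnessLib

/-!
# Carrillo–Ni's Cor. 4.1 (closed case) is a theorem of the tree:
# `carrilloNi_muEntropy_eq_log_shrinkerDensity_holds`

Sibling proof file of `GradientShrinker.lean` (D-0014: theorems only, no definitions, no named
facts) discharging the named fact
`Literature.Geometry.Riemannian.carrilloNi_muEntropy_eq_log_shrinkerDensity` (Carrillo–Ni 2009,
Cor. 4.1, closed case: on a closed connected normalised gradient shrinker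
`Ric + Hess f = g/2`, `R + |∇f|² = f`, Perelman's `μ(g, 1)` equals `log Θ`,
`Θ = (4π)^{-n/2} ∫ e^{-f} dV`).

`WeightedHeatFlowFromLinearHeat.lean` reduced the fact to the hypothesis `hLP` of
`perelman_noLocalCollapsing_of_linearHeat` — the solvability, `C^∞` on `M × [0, T]`, of the linear
heat-type Cauchy problem `∂ₛw = Δ_{h(s)} w − Q w`, `w(0) = w₀` on a closed manifold modelled on
`ℝᵐ`, for a family of Riemannian metrics `h` and a potential `Q` that are `C^∞` on `M × [0, T]`
(`carrilloNi_muEntropy_eq_log_shrinkerDensity_of_linearHeat`). That theorem of linear parabolic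
theory has since LANDED for coefficients smooth on `M × ℝ` (`exists_linearHeat_Icc`,
`LinearHeatCauchyExistence.lean`: Friedman 1964, Ch. 3, Thm. 7; Trèves 1975, §41), together with
Seeley's smooth extension in time of metric families and scalar families from `M × [0, T]` to
`M × ℝ` (`exists_isContMDiffFamilyOn_extension`, `exists_contMDiff_timeExtension_fun`,
`MetricFamilyExtension.lean`) — exactly the pattern by which
`IsRicciFlow.exists_isConjugateHeatSolutionOn_Icc` (`PerelmanEntropyMonotonicityProofs.lean`)
discharged `perelman_noLocalCollapsing`. This file assembles the three:

* `exists_linearHeat_Icc_of_isContMDiffFamilyOn` — the hypothesis `hLP` verbatim (coefficients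
  `C^∞` on `M × [0, T]` only): extend `h` and `Q` to all times, solve with `exists_linearHeat_Icc`,
  and restrict the equation back to `[0, T]` where the extensions agree with the data;
* `carrilloNi_muEntropy_eq_log_shrinkerDensity_holds` — the discharge.

## References

* [CarrilloNi2009] J. A. Carrillo, L. Ni, *Sharp logarithmic Sobolev inequalities on gradient
  solitons and applications*, Comm. Anal. Geom. 17 (2009), §3–§4, Cor. 4.1.
* [Friedman1964] A. Friedman, *Partial differential equations of parabolic type*, Prentice-Hall
  1964, Ch. 3, Thm. 7.
* [Seeley1964] R. T. Seeley, *Extension of `C^∞` functions defined in a half space*, Proc. AMS 15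
  (1964), 625–626.
* [Topping2006] P. Topping, *Lectures on the Ricci flow* (2006), Rem. 8.2.5.
-/

noncomputable section

open Set Function Filter Manifold MeasureTheory
open scoped Manifold ContDiff Topology

namespace Literature.Geometry.Riemannian

open Lorentzian Lorentzian.PseudoRiemannianMetric

universe u

/-- **The linear heat-type Cauchy problem on a closed manifold modelled on `ℝᵐ`, coefficients
smooth on `M × [0, T]`** — verbatim the hypothesis `hLP` of
`perelman_noLocalCollapsing_of_linearHeat` and of
`carrilloNi_muEntropy_eq_log_shrinkerDensity_of_linearHeat`: for `T > 0`, a family `h` of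
Riemannian metrics and a potential `Q` that are `C^∞` on `M × [0, T]`, and a `C^∞` datum `w₀`,
there is `w`, `C^∞` on `M × [0, T]`, with `w(0) = w₀` and `∂ₛw = Δ_{h(s)} w − Q w` on `M × [0, T]`
(one-sided time derivative within `[0, T]`). Proof: extend `h` (keeping it Riemannian) and `Q`
smoothly to all times (Seeley), apply `exists_linearHeat_Icc`, and rewrite the extended
coefficients back to `h`, `Q` on `[0, T]`. [cite: Friedman1964, Ch. 3, Thm. 7]
[cite: Seeley1964, Theorem] -/
theorem exists_linearHeat_Icc_of_isContMDiffFamilyOn {m : ℕ} {H : Type u} [TopologicalSpace H]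
    (I : ModelWithCorners ℝ (EuclideanSpace ℝ (Fin m)) H) [I.Boundaryless]
    (M : Type u) [TopologicalSpace M] [T2Space M] [SecondCountableTopology M] [CompactSpace M]
    [ChartedSpace H M] [IsManifold I ∞ M] (T : ℝ) (hT : 0 < T)
    (h : ℝ → PseudoRiemannianMetric I ∞ (EuclideanSpace ℝ (Fin m)) (TangentSpace I : M → Type _))
    (hh : IsContMDiffFamilyOn ∞ h (Icc 0 T)) (hR : ∀ s ∈ Icc 0 T, (h s).IsRiemannian)
    (Q : ℝ → M → ℝ)
    (hQ : ContMDiffOn (I.prod 𝓘(ℝ, ℝ)) 𝓘(ℝ, ℝ) ∞ (fun p : M × ℝ ↦ Q p.2 p.1) (univ ×ˢ Icc 0 T))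
    (w₀ : M → ℝ) (hw₀ : ContMDiff I 𝓘(ℝ, ℝ) ∞ w₀) :
    ∃ w : ℝ → M → ℝ,
      ContMDiffOn (I.prod 𝓘(ℝ, ℝ)) 𝓘(ℝ, ℝ) ∞ (fun p : M × ℝ ↦ w p.2 p.1) (univ ×ˢ Icc 0 T) ∧
      w 0 = w₀ ∧
      ∀ s ∈ Icc 0 T, ∀ x : M, HasDerivWithinAt (fun r ↦ w r x)
        ((h s).laplaceBeltrami (w s) x - Q s x * w s x) (Icc 0 T) s := by
  borelize M
  -- extend the metric family (Riemannian at all times) and the potential to `M × ℝ` (Seeley)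
  obtain ⟨h', hh', hR', hh'eq⟩ := exists_isContMDiffFamilyOn_extension hT hh hR
  obtain ⟨Qe, hQe, hQeq⟩ := exists_contMDiff_timeExtension_fun hT hQ
  -- solve the Cauchy problem for the extended coefficients
  obtain ⟨w, hw, hw0, hweq⟩ := exists_linearHeat_Icc hh' hR' hQe hT hw₀
  refine ⟨w, hw, hw0, fun s hs x ↦ ?_⟩
  have key := hweq s hs x
  rwa [hh'eq s hs, hQeq s hs] at key

/-- **Carrillo–Ni 2009, Cor. 4.1 (closed case) — discharge of the named fact
`carrilloNi_muEntropy_eq_log_shrinkerDensity`**: on a closed connected Riemannian manifold with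
`Ric + Hess f = g/2` and `R + |∇f|² = f`, Perelman's `μ(g, 1) = log Θ`,
`Θ = (4π)^{-n/2} ∫_M e^{-f} dV`. It is `carrilloNi_muEntropy_eq_log_shrinkerDensity_of_linearHeat`
(the weighted heat flow `∂ₜu = Δu − g⁻¹(dV, du)` by conjugation and re-modelling on `ℝ^{dim E}`,
then the Bakry–Émery convergence argument of `WeightedHeatFlowAPriori` /
`GradientShrinkerProofs`) applied to the now-proved linear parabolic existence theorem
`exists_linearHeat_Icc_of_isContMDiffFamilyOn`. [cite: CarrilloNi2009, Cor. 4.1]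
[cite: Friedman1964, Ch. 3, Thm. 7] -/
theorem carrilloNi_muEntropy_eq_log_shrinkerDensity_holds :
    carrilloNi_muEntropy_eq_log_shrinkerDensity.{u} :=
  carrilloNi_muEntropy_eq_log_shrinkerDensity_of_linearHeat.{u}
    @fun _m _H _ I _ M _ _ _ _ _ _ T hT h hh hR Q hQ w₀ hw₀ ↦
      exists_linearHeat_Icc_of_isContMDiffFamilyOn I M T hT h hh hR Q hQ w₀ hw₀

end Literature.Geometry.Riemannian

end
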